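import Literature.AnabelianGeometry.SemiGraphs.MetabelianLeafStar
import Literature.AnabelianGeometry.SemiGraphs.MetabelianLeafStarLeafLevels
import Literature.AnabelianGeometry.SemiGraphs.TemperedQuasiCoherentOfLevels
import Literature.AnabelianGeometry.SemiGraphs.TemperedGaloisCountableOfStrictlyCoherent
import Literature.AnabelianGeometry.SemiGraphs.ThetaRayFreeProPQuasiCoherent
import HarnessLib

/-!
# `𝒢⋆(p)` is quasi-coherent, strictly coherent and Galois-countable («RAYLESS-STAR·CIV-NEG», brick S4, part 3)

Mochizuki, *Semi-graphs of anabelioids*, Publ. RIMS **42** (2006), Def. 2.3 (iii) p. 25 (quasi-coherent,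
coherent) [cite: MochizukiSemiAnbd2006, Def 2.3(iii) p.25]; [IUTchI] Rmk. 2.5.3 (i) (T2)–(T4) pp. 52–53
(Galois-countable, strictly coherent) [cite: Mochizuki2012, IUTchI Rem. 2.5.3(i) p.52].

PROOF-ONLY file (abc-iut cell, layer L3, row «RAYLESS-STAR·CIV-NEG», seat abc-iut-L3-t8 gen 6; desk memo §6).
For the rayless counter-carrier `𝒢⋆(p) = metabelianLeafStar p` (`MetabelianLeafStar.lean`):

* (H5) `metabelianLeafStar_isQuasiCoherent` — abc-iut-w4-d075's constructor `isQuasiCoherent_of_compatibleLevels`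
  fed with the levels of `MetabelianLeafStarLevels.lean` / `…LeafLevels.lean`: at the bound `M`, the centre
  level `charOpenCore F̂₂⁽ᵖ⁾ M ⊓ ab⁻¹(p^M ℤ_p²)`, the leaf levels `ker(Leaf n → P_M × ℤ_p/W_M)` (index bounded
  UNIFORMLY in `n`), the edge level `W_M = α⁻¹(centre level)` — to which EVERY gluing pulls the vertex levels
  back (`comap_θα_centreLevel`, `comap_lowHom_leafLevel`);
* (T3) `metabelianLeafStar_isStrictlyCoherent` — every vertex / edge group is topologically 2-generated
  (`Iw.topologicalClosure_closure_pair_leaf`: the leaf `ℤ_p ⋊ ⟨1+p^{n+1}⟩‾` by the translation and `sig n`);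
* (H4) `metabelianLeafStar_isGaloisCountable` — by abc-iut-w4-d075's (T4) `isGaloisCountable_of_isStrictlyCoherent`.

No definition, no named fact; no side taken on [IUTchIII] Cor 3.12.
-/

noncomputable section

open scoped Pointwise
open Topology Multiplicative

namespace Literature.AnabelianGeometry.SemiGraphs

open IwahoriWitness

variable {p : ℕ} [hp : Fact p.Prime]

/-! ### The leaves are topologically 2-generated -/

namespace Iw

/-- The translation `transl = (1, 0)` as an element of the leaf. [cite: MochizukiSemiAnbd2006, §2 p.23] -/
def translLeaf (n : ℕ) : Leaf (p := p) n := ⟨transl, transl_mem_leaf n⟩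

/-- `sig n = (0, p^n)` as an element of the leaf. [cite: MochizukiSemiAnbd2006, §2 p.23] -/
def sigLeaf (n : ℕ) : Leaf (p := p) n := ⟨sig n, sig_mem_leaf n⟩

/-- `translHom n k = translLeaf n ^ k` for integers `k`. [cite: MochizukiSemiAnbd2006, §2 p.23] -/
theorem translHom_ofAdd_intCast (n : ℕ) (k : ℤ) :
    translHom (p := p) n (ofAdd (k : ℤ_[p])) = translLeaf n ^ k := by
  rw [FreeProPRankTwo.ofAdd_intCast_eq_pow p, map_zpow]
  rfl

/-- `lowHom n k = sigLeaf n ^ k` for integers `k`. [cite: MochizukiSemiAnbd2006, §2 p.23] -/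
theorem lowHom_ofAdd_intCast (n : ℕ) (k : ℤ) :
    lowHom (p := p) n (ofAdd (k : ℤ_[p])) = sigLeaf n ^ k := by
  rw [FreeProPRankTwo.ofAdd_intCast_eq_pow p, map_zpow]
  congr 1
  ext1
  exact coe_lowHom_ofAdd_one n

/-- The translation embedding is continuous. [cite: MochizukiSemiAnbd2006, §2 p.23] -/
theorem continuous_translHom (n : ℕ) : Continuous (translHom (p := p) n) := by
  refine Continuous.subtype_mk ?_ _
  exact (continuous_mk_iff (p := p)).2 ⟨continuous_toAdd, continuous_const⟩

/-- The range of a continuous homomorphism out of `ℤ_p` lies in the closure of any subgroup containing the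
image of `1` (density of `ℤ` in `ℤ_p`). [cite: RibesZalesskii2010, §4.1] -/
theorem range_subset_topologicalClosure_of_mem {G : Type*} [Group G] [TopologicalSpace G]
    [IsTopologicalGroup G] (f : Multiplicative ℤ_[p] →* G) (hf : Continuous f) (H : Subgroup G)
    (h1 : f (ofAdd 1) ∈ H) (t : Multiplicative ℤ_[p]) : f t ∈ H.topologicalClosure := by
  have ht : t ∈ closure ((Subgroup.zpowers (ofAdd (1 : ℤ_[p]))) : Set (Multiplicative ℤ_[p])) := by
    rw [← Subgroup.topologicalClosure_coe, FreeProPRankTwo.topologicalClosure_zpowers_ofAdd_one p]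
    trivial
  have himg := image_closure_subset_closure_image hf ⟨t, ht, rfl⟩
  rw [← SetLike.mem_coe, Subgroup.topologicalClosure_coe]
  refine closure_mono ?_ himg
  rintro _ ⟨_, ⟨m, rfl⟩, rfl⟩
  change f (ofAdd (1 : ℤ_[p]) ^ m) ∈ (H : Set G)
  rw [map_zpow]
  exact H.zpow_mem h1 m

/-- **The leaf `ℤ_p ⋊ ⟨1 + p^{n+1}⟩‾` is topologically generated by the translation and `sig n`.**
[cite: Mochizuki2012, IUTchI Rem. 2.5.3(i)(T3) p.53] -/
theorem topologicalClosure_closure_pair_leaf (n : ℕ) :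
    (Subgroup.closure ({translLeaf n, sigLeaf n} : Set (Leaf (p := p) n))).topologicalClosure = ⊤ := by
  set H : Subgroup (Leaf (p := p) n) := Subgroup.closure ({translLeaf n, sigLeaf n} : Set (Leaf (p := p) n))
  rw [eq_top_iff]
  intro x _
  have hx := translHom_mul_lowHom n x
  rw [← hx]
  refine H.topologicalClosure.mul_mem ?_ ?_
  · exact range_subset_topologicalClosure_of_mem (translHom n) (continuous_translHom n) H
      (by
        rw [show (ofAdd (1 : ℤ_[p])) = ofAdd ((1 : ℤ) : ℤ_[p]) by rw [Int.cast_one], translHom_ofAdd_intCast,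
          zpow_one]
        exact Subgroup.subset_closure (Set.mem_insert _ _)) _
  · exact range_subset_topologicalClosure_of_mem (lowHom n).toMonoidHom (lowHom (p := p) n).continuous H
      (by
        change lowHom n (ofAdd 1) ∈ H
        rw [show (ofAdd (1 : ℤ_[p])) = ofAdd ((1 : ℤ) : ℤ_[p]) by rw [Int.cast_one], lowHom_ofAdd_intCast,
          zpow_one]
        exact Subgroup.subset_closure (Set.mem_insert_of_mem _ (Set.mem_singleton _))) _

/-- A generating pair of the leaf as a `Finset` of cardinality `≤ 2`. [cite: Mochizuki2012, IUTchI Rem. 2.5.3(i)(T3) p.53] -/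
theorem exists_generating_finset_leaf (n : ℕ) :
    ∃ s : Finset (Leaf (p := p) n), s.card ≤ 2 ∧
      (Subgroup.closure (s : Set (Leaf (p := p) n))).topologicalClosure = ⊤ := by
  classical
  refine ⟨{translLeaf n, sigLeaf n}, Finset.card_le_two, ?_⟩
  rw [Finset.coe_insert, Finset.coe_singleton]
  exact topologicalClosure_closure_pair_leaf n

end Iw

/-! ### Quasi-coherence of `𝒢⋆(p)` -/

namespace ProfiniteSemiGraph

variable (p)

/-- The vertex levels of `𝒢⋆(p)` at the bound `M`: the centre level at the centre, the leaf level (over the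
edge level `W_M`) at the leaf `n`. [cite: MochizukiSemiAnbd2006, Def 2.3(iii) p.25] -/
def leafStarVertexLevel (M : ℕ) : ∀ v : (metabelianLeafStar p).graph.Vertex, Subgroup ((metabelianLeafStar p).Gv v)
  | none => FreeProPRankTwo.centreLevel p M
  | some n => Iw.leafLevel (FreeProPRankTwo.edgeLevel p M) n M

/-- **(H5) `𝒢⋆(p)` is QUASI-COHERENT.** [cite: MochizukiSemiAnbd2006, Def 2.3(iii) p.25] -/
theorem metabelianLeafStar_isQuasiCoherent : (metabelianLeafStar p).IsQuasiCoherent := by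
  refine isQuasiCoherent_of_compatibleLevels (leafStarVertexLevel p)
    (fun M _ => FreeProPRankTwo.edgeLevel p M) ?_ ?_ ?_ ?_ ?_ ?_ ?_ ?_ ?_
  · rintro M (_ | n)
    · exact FreeProPRankTwo.centreLevel_normal p M
    · exact Iw.leafLevel_normal _ n M
  · intro M e
    exact (inferInstance : (FreeProPRankTwo.edgeLevel p M).Normal)
  · rintro M (_ | n)
    · exact FreeProPRankTwo.isOpen_centreLevel p M
    · exact Iw.isOpen_leafLevel _ (FreeProPRankTwo.isOpen_edgeLevel p M) n M
  · intro M e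
    exact FreeProPRankTwo.isOpen_edgeLevel p M
  · intro M
    refine ⟨max (FreeProPRankTwo.centreLevel p M).index
      (Nat.card (IwMod p M × (Multiplicative ℤ_[p] ⧸ FreeProPRankTwo.edgeLevel p M))), ?_⟩
    rintro (_ | n)
    · exact ⟨FreeProPRankTwo.centreLevel_index_ne_zero p M, le_max_left _ _⟩
    · obtain ⟨h0, hle⟩ := Iw.leafLevel_index_le _ (FreeProPRankTwo.isOpen_edgeLevel p M) n M
      exact ⟨h0, hle.trans (le_max_right _ _)⟩
  · intro M e
    exact FreeProPRankTwo.edgeLevel_index_ne_zero p M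
  · rintro M ⟨n, c⟩ v h
    have hv : SemiGraph.leafStarVertexOf (n, c) = v := Option.some.inj h
    subst hv
    cases c
    · exact Iw.comap_lowHom_leafLevel _ (fun t ht => FreeProPRankTwo.dvd_of_mem_edgeLevel p ht) n
    · exact FreeProPRankTwo.comap_θα_centreLevel p M n
  · rintro M (_ | n) X hfin hcard g hg x
    · haveI := hfin
      exact FreeProPRankTwo.centreLevel_fixes p M X hcard hg x
    · haveI := hfin
      exact Iw.leafLevel_fixes _ (fun t ht => FreeProPRankTwo.dvd_of_mem_edgeLevel p ht) n X hcard hg x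
  · intro M e X hfin hcard g hg x
    haveI := hfin
    exact FreeProPRankTwo.edgeLevel_fixes p M X hcard hg x

/-- **(T3) `𝒢⋆(p)` is STRICTLY COHERENT**: quasi-coherent with all vertex and edge groups topologically
2-generated. [cite: Mochizuki2012, IUTchI Rem. 2.5.3(i)(T3) p.53] -/
theorem metabelianLeafStar_isStrictlyCoherent : (metabelianLeafStar p).IsStrictlyCoherent := by
  classical
  have hV : ∀ v : (metabelianLeafStar p).graph.Vertex, ∃ s : Finset ((metabelianLeafStar p).Gv v),
      s.card ≤ 2 ∧ (Subgroup.closure (s : Set ((metabelianLeafStar p).Gv v))).topologicalClosure = ⊤ := by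
    rintro (_ | n)
    · exact FreeProPRankTwo.exists_generating_finset p
    · exact Iw.exists_generating_finset_leaf n
  have hE : ∀ e : (metabelianLeafStar p).graph.Edge, ∃ s : Finset ((metabelianLeafStar p).Ge e),
      s.card ≤ 2 ∧ (Subgroup.closure (s : Set ((metabelianLeafStar p).Ge e))).topologicalClosure = ⊤ := by
    intro e
    change ∃ s : Finset (Multiplicative ℤ_[p]), s.card ≤ 2 ∧
      (Subgroup.closure (s : Set (Multiplicative ℤ_[p]))).topologicalClosure = ⊤
    refine ⟨{ofAdd (1 : ℤ_[p])}, by rw [Finset.card_singleton]; norm_num, ?_⟩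
    rw [Finset.coe_singleton]
    exact padicInt_topologicalClosure_closure_ofAdd_one p
  refine ⟨⟨metabelianLeafStar_isQuasiCoherent p, fun v => ?_, fun e => ?_⟩, 2, by norm_num,
    fun v => hV v, fun e => hE e⟩
  · obtain ⟨s, -, hs⟩ := hV v; exact ⟨s, hs⟩
  · obtain ⟨s, -, hs⟩ := hE e; exact ⟨s, hs⟩

/-- **(H4) `𝒢⋆(p)` is GALOIS-COUNTABLE** ([IUTchI] Rmk. 2.5.3 (i) (T2), via (T4)).
[cite: Mochizuki2012, IUTchI Rem. 2.5.3(i)(T2) p.52] -/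
theorem metabelianLeafStar_isGaloisCountable : (metabelianLeafStar p).IsGaloisCountable :=
  isGaloisCountable_of_isStrictlyCoherent (starOfLeaves_isConnected _ _ _ _) (starOfLeaves_hasVertex _ _ _ _)
    (starOfLeaves_isCountable _ _ _ _) (metabelianLeafStar_isStrictlyCoherent p)

end ProfiniteSemiGraph

end Literature.AnabelianGeometry.SemiGraphs

end
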